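import Summits.QuantumFields.YangMills.Theorems.TwistedTraceScaling.Negative.StrongCouplingKernelBridge
import Summits.QuantumFields.YangMills.Theorems.LuscherReductionTraceDoorDefs
import HarnessLib

/-!
# `TwistedTraceScaling` (crux stmt-QuantumFields-20203, route `LuscherReduction`, skeleton «twolattice»):
# negative-side support (R73b) — `P_L ≤ c^T Z^{cyc}_L` and the dyadic trace ratio at strong coupling, UNIFORMLY in the volume

HONEST FRAMING: `TwistedTraceScaling` is a femto-rung (R2b1) crux of a CONDITIONAL reduction route; nothing here is a mass-gap or
Clay statement, and this file does NOT refute the crux.  All objects are the tree's (`FemtoTransferGap.transferKernel`, `transferApply`,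
`physL2`, `levelValue`, `TT.physTrace(Succ)`, `TraceDoor.traceRatio`) and the Literature's (`wilsonSliceKernel`, `wilsonTorusTransferMatrix`,
`cyclicPartition`, `transferSpectralRadius`, `traceExcess`, `Balaban1983to89.Missing.strongCouplingRadius`).  No proposition and no
definition is introduced (the normalisation constant `c_{β,L} = exp(β Σ_{x,i} 2)` is written out).

Content (`StrongRoot`, continuing `StrongCouplingKernelBridge`).  On the physical closed subspace (a.e. gauge-invariant classes)
`c_{β,L} · 𝕎 v = A v` (`sliceConst_smul_wilsonTorusTransferMatrix_eq`), so the tree's physical eigen-sequence (eigenvalues `levelValue k`,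
`exists_eigenseq_levelValue`) is an orthonormal `𝕎`-eigen-sequence (`exists_physEigenseq_wilsonTorusTransferMatrix`); Parseval in the
Literature's Hilbert–Schmidt eigenbasis of `𝕎` plus Bessel for the physical orthonormal family give
`P_L(β, m+2) ≤ c_{β,L}^{m+2} · Z^{cyc}_L(β, m+2)` (`physTraceSucc_le_pow_mul_cyclicPartition`).  With `c_{β,L}·λ₊ ≤ λ₀` and the landed
volume-uniform strong-coupling expansion `Missing.traceExcess_le_of_strongCoupling` this yields
`StrongRoot.one_sub_le_traceRatio_of_strongCoupling`: for `0 < β ≤ r_{su2}` and `T ≥ 2`, `r_L(β,T) = P_L(2T)/P_L(T)² ≥ 1 − 24 L³ T e^{−⌊T/2⌋}`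
UNIFORMLY IN `L` — the `L`-uniform time-direction cluster bound on the vacuum-free trace ratio that the crux workfile's §E near-miss
(`Cruxes/TwistedTraceScaling/Disproof.lean`) recorded as the missing ingredient.
-/

set_option autoImplicit false

noncomputable section

open MeasureTheory Filter Topology Real
open Literature.MathematicalPhysics.QuantumFieldTheory hiding SU2
open Literature.MathematicalPhysics.QuantumLattice
open Literature.Analysis.OperatorTheory.YMMatrixModel
open Literature.Analysis.OperatorTheory
open scoped InnerProductSpace BigOperators

namespace Summit.QuantumFields.YangMills.Theorems.TwistedTraceScaling.Negative

open Summit.QuantumFields.YangMills.Theorems.FemtoTransferGap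
open Summit.QuantumFields.YangMills.Theorems.FemtoTransferGap.TT
open Summit.QuantumFields.YangMills.Theorems.FemtoTransferGap.PhysL2
open Summit.QuantumFields.YangMills.Theorems.FemtoTransferGap.TraceDoor

namespace StrongRoot

variable {L : ℕ} [NeZero L]

/-! ## The trace comparison `P_L(β, m+2) ≤ c^{m+2} · Z^{cyc}_L(β, m+2)` -/

/-- For a PHYSICAL class `v` (a.e. gauge invariant), `c_{β,L} ∫ W_β(U,V) v(V) dV = (K_β v)(U)` for every `U`. [folklore] -/
theorem sliceConst_mul_integral_wilsonSliceKernel_of_mem_physL2 (β : ℝ) {v : Lp ℝ 2 (configMeasure SU2 L)} (hv : v ∈ physL2 L)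
    (U : GaugeConfig 3 L SU2) :
    Real.exp (β * ∑ _x : Site 3 L, ∑ _i : Fin 3, (2 : ℝ)) * ∫ V, wilsonSliceKernel su2Rep β U V * v V ∂(configMeasure SU2 L) =
      transferApply β (v : GaugeConfig 3 L SU2 → ℝ) U := by
  haveI : SecondCountableTopology SU2 := secondCountableTopology_su2
  haveI := isProbabilityMeasure_gaugeMeasure (L := L)
  have hvm : Measurable (v : GaugeConfig 3 L SU2 → ℝ) := (Lp.stronglyMeasurable v).measurable
  rw [sliceConst_mul_integral_wilsonSliceKernel_mul]
  have h : ∀ g : Site 3 L → SU2, ∫ V, transferKernel su2Rep β U (gaugeTransform g V) * v V ∂(configMeasure SU2 L) =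
      transferApply β (v : GaugeConfig 3 L SU2 → ℝ) U := fun g => by
    rw [transferApply_apply]
    have hF : Measurable fun V => transferKernel su2Rep β U V * (v : GaugeConfig 3 L SU2 → ℝ) (gaugeTransform g⁻¹ V) :=
      (continuous_transferKernel_right β U).measurable.mul
        (hvm.comp (measurePreserving_gaugeTransform_configMeasure (G := SU2) g⁻¹).measurable)
    have h1 : (fun V => transferKernel su2Rep β U (gaugeTransform g V) * (v : GaugeConfig 3 L SU2 → ℝ) V) =
        fun V => (fun V' => transferKernel su2Rep β U V' * (v : GaugeConfig 3 L SU2 → ℝ) (gaugeTransform g⁻¹ V')) (gaugeTransform g V) := by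
      funext V; simp only [gaugeTransform_inv_gaugeTransform]
    rw [h1, integral_comp_eq_of_measurePreserving (measurePreserving_gaugeTransform_configMeasure g) hF]
    refine integral_congr_ae ?_
    filter_upwards [ae_gaugeInv_of_mem_physL2 g⁻¹ hv] with V hV
    rw [hV]
  simp_rw [h]
  simp

/-- **On the physical subspace `c_{β,L} · 𝕎 = A`** (the tree's `L²` transfer operator of `K_β`). [folklore] -/
theorem sliceConst_smul_wilsonTorusTransferMatrix_eq (β : ℝ) {A : Lp ℝ 2 (configMeasure SU2 L) →L[ℝ] Lp ℝ 2 (configMeasure SU2 L)}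
    (hA : ∀ v : Lp ℝ 2 (configMeasure SU2 L),
      (A v : GaugeConfig 3 L SU2 → ℝ) =ᵐ[configMeasure SU2 L] fun U => ∫ V, transferKernel su2Rep β U V * v V ∂configMeasure SU2 L)
    {v : Lp ℝ 2 (configMeasure SU2 L)} (hv : v ∈ physL2 L) :
    Real.exp (β * ∑ _x : Site 3 L, ∑ _i : Fin 3, (2 : ℝ)) • wilsonTorusTransferMatrix su2Rep β L v = A v := by
  haveI : SecondCountableTopology SU2 := secondCountableTopology_su2
  apply Lp.ext
  have h1 := Lp.coeFn_smul (Real.exp (β * ∑ _x : Site 3 L, ∑ _i : Fin 3, (2 : ℝ))) (wilsonTorusTransferMatrix su2Rep β L v)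
  have h2 := wilsonTorusTransferMatrix_ae_eq β L continuous_su2Rep v
  filter_upwards [h1, h2, hA v] with U hU1 hU2 hU3
  rw [hU1, Pi.smul_apply, hU2, smul_eq_mul]
  exact (sliceConst_mul_integral_wilsonSliceKernel_of_mem_physL2 β hv U).trans
    ((transferApply_apply β _ U).trans hU3.symm)

/-- **The physical eigen-sequence is an eigen-sequence of Lüscher's transfer matrix**: orthonormal `u_k` with `𝕎 u_k = (λ_k / c_{β,L}) u_k`,
`λ_k` the min–max values. [cite: ReedSimonIV1978, Thm. XIII.1–2] -/
theorem exists_physEigenseq_wilsonTorusTransferMatrix {β : ℝ} (hβ : 0 < β) :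
    ∃ (u : ℕ → Lp ℝ 2 (Measure.pi fun _ : Edge 3 L => haarProbability SU2)) (ev : ℕ → ℝ), Orthonormal ℝ u ∧
      (∀ k, wilsonTorusTransferMatrix su2Rep β L (u k) = (ev k / Real.exp (β * ∑ _x : Site 3 L, ∑ _i : Fin 3, (2 : ℝ))) • u k) ∧
      ∀ k, ev k = levelValue su2Rep L β k := by
  haveI : SecondCountableTopology SU2 := secondCountableTopology_su2
  obtain ⟨A, hA, -, -⟩ := exists_transferOpL2 (L := L) β
  obtain ⟨e, ev, hon, hAe, -, hev, -⟩ := exists_eigenseq_levelValue (L := L) hβ hA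
  obtain ⟨u, hu⟩ : ∃ u : ℕ → Lp ℝ 2 (Measure.pi fun _ : Edge 3 L => haarProbability SU2),
      ∀ k, u k = (e k : Lp ℝ 2 (configMeasure SU2 L)) := ⟨fun k => (e k : Lp ℝ 2 (configMeasure SU2 L)), fun _ => rfl⟩
  have hc0 : (0 : ℝ) < Real.exp (β * ∑ _x : Site 3 L, ∑ _i : Fin 3, (2 : ℝ)) := Real.exp_pos _
  refine ⟨u, ev, ?_, fun k => ?_, hev⟩
  · have hu' : u = fun k => (e k : Lp ℝ 2 (configMeasure SU2 L)) := funext hu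
    rw [hu']
    exact (physL2 L).subtypeₗᵢ.orthonormal_comp_iff.mpr hon
  · have h2 : Real.exp (β * ∑ _x : Site 3 L, ∑ _i : Fin 3, (2 : ℝ)) • wilsonTorusTransferMatrix su2Rep β L (e k : Lp ℝ 2 (configMeasure SU2 L)) = A (e k) :=
      sliceConst_smul_wilsonTorusTransferMatrix_eq β hA (e k).2
    refine smul_right_injective (Lp ℝ 2 (Measure.pi fun _ : Edge 3 L => haarProbability SU2)) hc0.ne' ?_
    simp only
    rw [smul_smul, mul_div_cancel₀ _ hc0.ne', hu k]
    exact h2.trans (hAe k)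

/-- **`P_L(β, m+2) ≤ c_{β,L}^{m+2} · Z^{cyc}_L(β, m+2)`** (`β > 0`): the tree's physical zero-flux trace is at most the Literature's cyclic
partition function (all 't Hooft flux sectors, i.e. the full trace of `𝕋^{m+2}`), after normalisation — the physical eigen-sequence is a
`𝕎`-eigen-sequence, so Parseval in the Hilbert–Schmidt eigenbasis of `𝕎` and Bessel over the orthonormal sub-family give the comparison of
eigenvalue power sums. [cite: ReedSimonI1980, Thm. VI.22–VI.23] -/
theorem physTraceSucc_le_pow_mul_cyclicPartition {β : ℝ} (hβ : 0 < β) (m : ℕ) :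
    physTraceSucc L β (m + 1) ≤ Real.exp (β * ∑ _x : Site 3 L, ∑ _i : Fin 3, (2 : ℝ)) ^ (m + 2) * cyclicPartition su2Rep β L (m + 2) := by
  haveI : SecondCountableTopology SU2 := secondCountableTopology_su2
  obtain ⟨u, ev, hu_on, hWu, hev⟩ := exists_physEigenseq_wilsonTorusTransferMatrix (L := L) hβ
  obtain ⟨s, _, b, lam, i₀, hb, hord, -, -, -, -, hZ⟩ :=
    exists_spectralData_wilsonTorusTransferMatrix L continuous_su2Rep su2Rep_mem_unitaryGroup hβ.le
  set c : ℝ := Real.exp (β * ∑ _x : Site 3 L, ∑ _i : Fin 3, (2 : ℝ)) with hc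
  have hc0 : 0 < c := Real.exp_pos _
  set W := wilsonTorusTransferMatrix su2Rep β L with hW
  have hWsa : IsSelfAdjoint W := isSelfAdjoint_wilsonTorusTransferMatrix (L := L) continuous_su2Rep su2Rep_mem_unitaryGroup β
  -- the termwise identity `(λ_k/c)^{m+2} ⟪b_i, u_k⟫² = lam_i^{m+2} ⟪b_i, u_k⟫²`
  have hterm : ∀ (i : s) (k : ℕ), (ev k / c) ^ (m + 2) * ⟪(b i), u k⟫_ℝ ^ 2 = lam i ^ (m + 2) * ⟪(b i), u k⟫_ℝ ^ 2 := fun i k => by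
    by_cases h0 : ⟪(b i), u k⟫_ℝ = 0
    · simp [h0]
    · have hs := hWsa.isSymmetric (b i) (u k)
      simp only [ContinuousLinearMap.coe_coe] at hs
      rw [hb i, hWu k, real_inner_smul_left, real_inner_smul_right] at hs
      rw [mul_right_cancel₀ h0 hs]
  -- Parseval for each `u_k` in the basis `b`
  have hpars : ∀ k, HasSum (fun i : s => ⟪(b i), u k⟫_ℝ ^ 2) 1 := fun k => by
    have h := b.hasSum_inner_mul_inner (u k) (u k)
    have h1 : ⟪u k, u k⟫_ℝ = 1 := by rw [real_inner_self_eq_norm_sq, hu_on.1 k]; ring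
    have h' : (fun i : s => ⟪(b i), u k⟫_ℝ ^ 2) = fun i : s => ⟪u k, b i⟫_ℝ * ⟪(b i), u k⟫_ℝ := by
      funext i; rw [sq, real_inner_comm]
    rw [h']; rwa [h1] at h
  -- finite partial sums
  have hfin : ∀ S : Finset ℕ, ∑ k ∈ S, ev k ^ (m + 2) ≤ c ^ (m + 2) * cyclicPartition su2Rep β L (m + 2) := fun S => by
    have h1 : HasSum (fun i : s => ∑ k ∈ S, lam i ^ (m + 2) * ⟪(b i), u k⟫_ℝ ^ 2) (∑ k ∈ S, (ev k / c) ^ (m + 2)) := by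
      refine hasSum_sum fun k _ => ?_
      have h := (hpars k).mul_left ((ev k / c) ^ (m + 2))
      rw [mul_one] at h
      simpa only [hterm] using h
    have h2 : ∀ i : s, ∑ k ∈ S, lam i ^ (m + 2) * ⟪(b i), u k⟫_ℝ ^ 2 ≤ lam i ^ (m + 2) := fun i => by
      rw [← Finset.mul_sum]
      have hB : ∑ k ∈ S, ⟪(b i), u k⟫_ℝ ^ 2 ≤ 1 := by
        have h := hu_on.sum_inner_products_le (b i) (s := S)
        rw [b.orthonormal.1 i, one_pow] at h
        refine le_trans (le_of_eq (Finset.sum_congr rfl fun k _ => ?_)) h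
        rw [Real.norm_eq_abs, sq_abs, real_inner_comm]
      calc lam i ^ (m + 2) * ∑ k ∈ S, ⟪(b i), u k⟫_ℝ ^ 2 ≤ lam i ^ (m + 2) * 1 :=
            mul_le_mul_of_nonneg_left hB (pow_nonneg (hord i).1 _)
        _ = lam i ^ (m + 2) := mul_one _
    have h3 : ∑ k ∈ S, (ev k / c) ^ (m + 2) ≤ cyclicPartition su2Rep β L (m + 2) := hasSum_le h2 h1 (hZ m)
    have h4 : ∑ k ∈ S, ev k ^ (m + 2) = c ^ (m + 2) * ∑ k ∈ S, (ev k / c) ^ (m + 2) := by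
      rw [Finset.mul_sum]
      refine Finset.sum_congr rfl fun k _ => ?_
      rw [div_pow, mul_div_cancel₀ _ (pow_ne_zero _ hc0.ne')]
    rw [h4]
    exact mul_le_mul_of_nonneg_left h3 (pow_nonneg hc0.le _)
  have hsum : HasSum (fun k => ev k ^ (m + 2)) (physTraceSucc L β (m + 1)) := by
    have h := hasSum_levelValue_pow_physTraceSucc (L := L) hβ m
    simpa only [← hev] using h
  exact hasSum_le_of_sum_le hsum hfin

/-! ## The dyadic trace ratio at strong coupling, uniformly in the volume -/

/-- `P_L(β, T) > 0` for `β > 0`, `T ≥ 1` (the top term `λ₀^T > 0` of the trace formula). [folklore] -/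
theorem physTrace_pos {β : ℝ} (hβ : 0 < β) (n : ℕ) : 0 < physTrace L β (n + 2) := by
  have hsum := hasSum_levelValue_pow_physTraceSucc (L := L) hβ n
  have h : levelValue su2Rep L β 0 ^ (n + 2) ≤ physTraceSucc L β (n + 1) :=
    le_hasSum hsum 0 fun k _ => pow_nonneg (levelValue_su2Rep_nonneg L hβ.le k) _
  exact lt_of_lt_of_le (pow_pos (levelValue_zero_su2Rep_pos L β) _) h

/-- **The vacuum-free dyadic trace ratio is exponentially close to `1` on the strong-coupling window, UNIFORMLY IN `L`**:
`r_L(β, T) ≥ 1 − 24 L³ T e^{−⌊T/2⌋}` for `0 < β ≤ r_{su2}` and `T ≥ 2` — numerator `P_L(2T) ≥ λ₀^{2T} ≥ (c·λ₊)^{2T}`, denominator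
`P_L(T) ≤ c^T Z^{cyc}(T) ≤ c^T λ₊^T exp(12 L³ T e^{−⌊T/2⌋})` by the Literature's strong-coupling cluster expansion of the cold torus
(`Balaban1983to89.Missing.traceExcess_le_of_strongCoupling`). [cite: OsterwalderSeiler1978, §3] [cite: KoteckyPreiss1986, (1)] -/
theorem one_sub_le_traceRatio_of_strongCoupling {β : ℝ} (hβ0 : 0 < β)
    (hβr : β ≤ Balaban1983to89.Missing.strongCouplingRadius su2Rep) {T : ℕ} (hT : 2 ≤ T) :
    1 - 24 * (L : ℝ) ^ 3 * T * Real.exp (-((T / 2 : ℕ) : ℝ)) ≤ traceRatio L β T := by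
  haveI : SecondCountableTopology SU2 := secondCountableTopology_su2
  obtain ⟨n, rfl⟩ : ∃ n, T = n + 2 := ⟨T - 2, by omega⟩
  set c : ℝ := Real.exp (β * ∑ _x : Site 3 L, ∑ _i : Fin 3, (2 : ℝ)) with hc
  have hc0 : 0 < c := Real.exp_pos _
  set l := transferSpectralRadius su2Rep β L with hl
  have hl0 : 0 < l :=
    Balaban1983to89.Missing.transferSpectralRadius_pos_of_unitary su2Rep continuous_su2Rep su2Rep_mem_unitaryGroup hβ0.le L
  set η : ℝ := 12 * (L : ℝ) ^ 3 * ((n : ℝ) + 2) * Real.exp (-(((n + 2) / 2 : ℕ) : ℝ)) with hη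
  -- the strong-coupling expansion: `Z(n+2) ≤ l^{n+2} e^{η}`
  have hX := Balaban1983to89.Missing.traceExcess_le_of_strongCoupling su2Rep continuous_su2Rep su2Rep_mem_unitaryGroup
    hβ0.le hβr L n
  have hZle : cyclicPartition su2Rep β L (n + 2) ≤ l ^ (n + 2) * Real.exp η := by
    have h1 : cyclicPartition su2Rep β L (n + 2) / l ^ (n + 2) ≤ Real.exp η := by
      have h2 := hX
      unfold traceExcess at h2
      linarith
    rwa [div_le_iff₀ (pow_pos hl0 _), mul_comm] at h1
  -- denominator
  have hPT : physTrace L β (n + 2) ≤ c ^ (n + 2) * (l ^ (n + 2) * Real.exp η) :=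
    (physTraceSucc_le_pow_mul_cyclicPartition (L := L) hβ0 n).trans (mul_le_mul_of_nonneg_left hZle (pow_nonneg hc0.le _))
  have hPTpos : 0 < physTrace L β (n + 2) := physTrace_pos hβ0 n
  -- numerator
  have hP2T : (c * l) ^ (2 * (n + 2)) ≤ physTrace L β (2 * (n + 2)) := by
    have hsum := hasSum_levelValue_pow_physTraceSucc (L := L) hβ0 (2 * n + 2)
    have hidx : 2 * (n + 2) - 1 = 2 * n + 2 + 1 := by omega
    have h1 : physTrace L β (2 * (n + 2)) = physTraceSucc L β (2 * n + 2 + 1) := by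
      simp only [physTrace, hidx]
    have h2 : levelValue su2Rep L β 0 ^ (2 * n + 2 + 2) ≤ physTraceSucc L β (2 * n + 2 + 1) :=
      le_hasSum hsum 0 fun k _ => pow_nonneg (levelValue_su2Rep_nonneg L hβ0.le k) _
    have h3 : c * l ≤ levelValue su2Rep L β 0 := sliceConst_mul_transferSpectralRadius_le hβ0.le
    have h4 : (c * l) ^ (2 * n + 2 + 2) ≤ levelValue su2Rep L β 0 ^ (2 * n + 2 + 2) :=
      pow_le_pow_left₀ (mul_pos hc0 hl0).le h3 _
    rw [h1, show 2 * (n + 2) = 2 * n + 2 + 2 by ring]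
    exact h4.trans h2
  -- the ratio
  have hexp : Real.exp (-2 * η) * Real.exp η ^ 2 = 1 := by
    rw [sq, ← Real.exp_add, ← Real.exp_add, show -2 * η + (η + η) = 0 by ring, Real.exp_zero]
  have hratio : Real.exp (-2 * η) ≤ traceRatio L β (n + 2) := by
    unfold traceRatio
    rw [le_div_iff₀ (pow_pos hPTpos 2)]
    calc Real.exp (-2 * η) * physTrace L β (n + 2) ^ 2
        ≤ Real.exp (-2 * η) * (c ^ (n + 2) * (l ^ (n + 2) * Real.exp η)) ^ 2 :=
          mul_le_mul_of_nonneg_left (pow_le_pow_left₀ hPTpos.le hPT 2) (Real.exp_pos _).le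
      _ = (c * l) ^ (2 * (n + 2)) * (Real.exp (-2 * η) * Real.exp η ^ 2) := by ring
      _ = (c * l) ^ (2 * (n + 2)) := by rw [hexp, mul_one]
      _ ≤ physTrace L β (2 * (n + 2)) := hP2T
  calc 1 - 24 * (L : ℝ) ^ 3 * ((n + 2 : ℕ) : ℝ) * Real.exp (-(((n + 2) / 2 : ℕ) : ℝ)) = -2 * η + 1 := by
        rw [hη]; push_cast; ring
    _ ≤ Real.exp (-2 * η) := Real.add_one_le_exp _
    _ ≤ traceRatio L β (n + 2) := hratio

end StrongRoot

end Summit.QuantumFields.YangMills.Theorems.TwistedTraceScaling.Negative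

end
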